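import Literature.Analysis.FluidPDE.Axisymmetric
import Literature.Analysis.FluidPDE.SwirlTransportProofs
import HarnessLib

/-!
# Liu–Xu 2023: global strong solutions for almost axisymmetric data (3-D Navier–Stokes)

Topic `Literature/Analysis/FluidPDE`; one named fact (a result in print that the tree has not
proved, `def … : Prop`, D-0014) with its vocabulary and proved API, typed for the blow-up
scenario census of cell `pub/ns-census` (row **F3w** «almost axisymmetric data: a PERTURBATIVE
window around row F3 (axisymmetric without swirl, EXCLUDED-IN-TREE) — small swirl and small
angular derivatives of the cylindrical components, smallness measured against double exponentials
of `‖u₀‖_{L²}⁶ ‖u₀‖_{Ḣ²}²`», EXCLUDED-IN-PRINT-NOT-TREE).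

Y. Liu, L. Xu, *On the existence and structures of almost axisymmetric solutions to 3-D
Navier–Stokes equations*, SIAM J. Math. Anal. 55 (2023) 458–485 = arXiv:2305.01046
[`LiuXu2023`].  System (1.1): (NS) on `ℝ⁺ × ℝ³`, `ν = 1`, no force; cylindrical coordinates and
frame `e_r, e_θ, e_z` as in `AxisymmetricEuler.lean` (p. 3); `C` "an universal constant" (p. 5,
Notations); `H^s` / `Ḣ^s` the (in)homogeneous `L²`-based Sobolev spaces (ibid.).

> (1.6) `‖f‖²_{Ḣ¹_axi} := ‖∇̃f‖²_{L²} + ‖f/r‖²_{L²}`, `‖f‖²_{H¹_axi} := ‖f‖²_{L²} + ‖f‖²_{Ḣ¹_axi}`,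
> where `∇̃ := e_r ∂_r + e_z ∂_z` is a part of the whole gradient.
>
> **Theorem 1.1** (p. 3).  Let `u₀ ∈ H²` with `div u₀ = 0` and
> `𝔘₀ := (∂_θ u^r₀, ∂_θ u^θ₀, ∂_θ u^z₀) ∈ H¹_axi`.  If there exists some small positive constant `ε`
> such that the following two smallness conditions hold:
> (1.7) `‖u^θ₀‖_{L²} ‖u^θ₀‖_{Ḣ¹_axi} exp(C ‖u₀‖_{L²}⁶ ‖u₀‖_{Ḣ²}²) < ε`,
> (1.8) `‖𝔘₀‖_{L²} ‖𝔘₀‖_{Ḣ¹_axi} exp(exp(C ‖u₀‖_{L²}⁶ ‖u₀‖_{Ḣ²}²)) < ε`,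
> then both (1.1) and [the axisymmetric system (1.4) from the `θ`-averaged datum] have unique
> global strong solutions `u` and `ū` in `C(ℝ₊; H¹) ∩ L²(ℝ₊; Ḣ¹ ∩ Ḣ²)` such that [closeness
> estimates (1.9)–(1.10) between `u`, `ū` and the `θ`-average of `u`].
>
> Remark 1.1 (i) (p. 4): "`u₀` is axisymmetric when `𝔘₀` vanishes … the smallness condition (1.8)
> actually tells us that `u₀` is close to some axisymmetric vector field.  That is what we mean
> 'almost axisymmetric'."

* `LiuXu2023.angularDerivVec u₀ x` — the vector `(∂_θu^r) e_r + (∂_θu^θ) e_θ + (∂_θu^z) e_z`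
  whose cylindrical components are `𝔘₀`, written frame-free as `Du₀(x)[J x] − J (u₀ x)` with
  `J = rotGen` the rotation generator (`−𝓡u₀` in the notation of Pineau–Vicol 2026 (6.2),
  `PineauVicolAngularMean.lean`: "`𝓡` acts on vector fields by applying `−∂_θ` to each
  cylindrical component separately");
* `LiuXu2023.hdotOneAxiDensity f x = |∇̃f|² + (f/r)²` and its vector version,
  `LiuXu2023.eHdotOneAxiSq f = ‖f‖²_{Ḣ¹_axi} ∈ [0, ∞]` (and `…Vec`);
* `LiuXu2023_almostAxisymmetric_global` — **Theorem 1.1** (global existence part) as a named fact.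

## Rendering (never stronger than print)

* `u^θ₀ = swirlVelocity u₀ = ⟪u₀, e_θ⟫`; `∂_r f = Df(x)[e_r(x)]`, `∂_z f = Df(x)[e_z]`, so
  `|∇̃f|² = (Df[e_r])² + (Df[e_z])²`; for the vector `𝔘₀ = Σᵢ Uⁱ eᵢ` the printed
  `‖𝔘₀‖²_{Ḣ¹_axi} = Σᵢ (‖∇̃Uⁱ‖² + ‖Uⁱ/r‖²)` equals `∫ |∂_r W|² + |∂_z W|² + |W|²/r²` for
  `W = angularDerivVec u₀` because the frame `e_r, e_θ, e_z` is constant along `∂_r` and `∂_z` and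
  orthonormal off the axis (a null set).  `‖u₀‖_{Ḣ²} := ‖Δu₀‖_{L²}` (`= ‖|ξ|² û₀‖_{L²}`, the
  homogeneous norm of p. 5).  All integrals are over `ℝ³` with Lebesgue measure (`= r dr dθ dz`).
* `ε` and `C` are universal constants whose values print does not give ("some small positive
  constant `ε`", "`C` … an universal constant"): the fact says `∃ ε > 0, ∃ C > 0, ∀ data …`.
* Finiteness of `‖u^θ₀‖_{Ḣ¹_axi}`, of `‖𝔘₀‖_{L²}`, `‖𝔘₀‖_{Ḣ¹_axi}` (print: `𝔘₀ ∈ H¹_axi`) and of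
  `‖Δu₀‖_{L²}` (print: `u₀ ∈ H²`) are explicit hypotheses, so the real numbers in (1.7)–(1.8)
  (`ENNReal.toReal`) carry no junk; `div u₀ = 0` and `u₀ ∈ L²` are inside the frame below.
* The census frame (that of `Row_F0`, as for `LiuZhang2023_largeFourierMode_global`): print proves
  EXISTENCE and uniqueness of a global strong solution from `u₀`; the fact says that a CLASSICAL
  solution of (1.1) (`ν = 1`, as printed) on `ℝ³ × [0, T)` which is Leray–Hopf on `[0, T)` with a
  rapidly decaying datum `u 0 = u₀` satisfying (1.7)–(1.8) extends past `T` — print composed with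
  weak–strong uniqueness (the strong class `C(ℝ₊;H¹) ∩ L²(ℝ₊;Ḣ²) ⊂ L⁴_t L^∞_x`) and interior
  smoothness of strong solutions, on the sub-class of smooth rapidly decaying data.  Not restated:
  uniqueness, the axisymmetrised companion `ū` and the estimates (1.9)–(1.10), Theorems 1.2–1.3
  (asymptotic expansions in `θ`).
  -- TODO(general form): `ν ≠ 1` by the scaling `v(t,x) = ν⁻¹ u(ν⁻¹ t, x)` (which puts the powers
  -- `ν⁻²`, `ν⁻⁸` into (1.7)–(1.8)); data in `H²` only.

## Mathlib / tree search

`lean search 'LiuXu|almostAxisym|angularDeriv|H1axi|Hdot1Axi'` (2026-08-28): nothing for the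
result.  Reused: `swirlVelocity`, `eR`, `eZ`, `cylRadius`, `IsAxisymmetric`
(`AxisymmetricEuler.lean`), `rotGen`, `IsAxisymmetric.fderiv_rotGen` (`SwirlTransportProofs.lean`),
`IsClassicalNSSolutionOn`, `HasSmoothExtensionPast`, `IsLerayHopfOn`, `HasRapidSpatialDecay`.
Neighbours: `axisymmetric_no_swirl_global_regularity` (row F3: `𝔘₀ = 0`, `u^θ₀ = 0`), the
small-swirl axisymmetric facts `LeiZhang2017…`, `Wei2016…` (tree), `LiuZhang2023_largeFourierMode_global`
(row F13N: large single modes instead of small angular derivatives).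

## References

* Y. Liu, L. Xu, SIAM J. Math. Anal. 55 (2023) 458–485, arXiv:2305.01046: §1.1 (1.1)–(1.5), §1.2
  (1.6), Thm 1.1 with (1.7)–(1.10), Rem 1.1 (pp. 3–4); Notations (p. 5); Prop 2.1 (stability,
  p. 6); §3 proof of Thm 1.1 (pp. 9–12). [`LiuXu2023`]
* B. Pineau, V. Vicol (2026), §6.1 (6.2): the operator `𝓡` (tree: `PineauVicolAngularMean.lean`).
-/

noncomputable section

open MeasureTheory Set Function Filter Topology TopologicalSpace
open scoped NNReal ENNReal Laplacian InnerProductSpace RealInnerProductSpace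

namespace Literature.Analysis.FluidPDE

namespace LiuXu2023

/-! ### The angular derivative of the cylindrical components and the `Ḣ¹_axi` seminorm -/

/-- **`𝔘 = (∂_θ u^r, ∂_θ u^θ, ∂_θ u^z)` as a vector field**: the field whose cylindrical components
are the `θ`-derivatives of the cylindrical components of `u`, frame-free:
`d/dφ|_{φ=0} R_{−φ} u(R_φ x) = Du(x)[J x] − J (u x)`, `J = rotGen` (`J x = r e_θ(x)`,
`d/dφ R_φ = J R_φ`).  It vanishes identically iff the components do not depend on `θ`, i.e. iff `u`
is axisymmetric (Rem 1.1 (i); `angularDerivVec_eq_zero_of_isAxisymmetric`).  Junk value where `u`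
is not differentiable (`fderiv = 0`). [cite: LiuXu2023, Thm 1.1 (definition of 𝔘₀) and Rem 1.1 (i)] -/
def angularDerivVec (u : EuclideanSpace ℝ (Fin 3) → EuclideanSpace ℝ (Fin 3))
    (x : EuclideanSpace ℝ (Fin 3)) : EuclideanSpace ℝ (Fin 3) :=
  fderiv ℝ u x (rotGen x) - rotGen (u x)

/-- The `Ḣ¹_axi` density of a scalar `f` on `ℝ³`: `|∇̃f|² + (f/r)²` with `∇̃ = e_r ∂_r + e_z ∂_z`,
`∂_r f = Df[e_r]`, `∂_z f = Df[e_z]` ((1.6)).  Junk `0/0 = 0` on the axis (a null set).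
[cite: LiuXu2023, (1.6)] -/
def hdotOneAxiDensity (f : EuclideanSpace ℝ (Fin 3) → ℝ) (x : EuclideanSpace ℝ (Fin 3)) : ℝ :=
  (fderiv ℝ f x (eR x)) ^ 2 + (fderiv ℝ f x eZ) ^ 2 + (f x / cylRadius x) ^ 2

/-- The `Ḣ¹_axi` density of a triple of scalars written as a vector field `W = Σᵢ Wⁱ eᵢ` in the
cylindrical frame: `Σᵢ (|∇̃Wⁱ|² + (Wⁱ/r)²) = |∂_r W|² + |∂_z W|² + |W|²/r²` (the frame is constant
along `∂_r`, `∂_z` and orthonormal off the axis) ((1.6) applied to `𝔘₀`). [cite: LiuXu2023, (1.6) and Thm 1.1 (𝔘₀ ∈ H¹_axi)] -/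
def hdotOneAxiDensityVec (W : EuclideanSpace ℝ (Fin 3) → EuclideanSpace ℝ (Fin 3))
    (x : EuclideanSpace ℝ (Fin 3)) : ℝ :=
  ‖fderiv ℝ W x (eR x)‖ ^ 2 + ‖fderiv ℝ W x eZ‖ ^ 2 + (‖W x‖ / cylRadius x) ^ 2

/-- `‖f‖²_{Ḣ¹_axi} = ∫_{ℝ³} (|∇̃f|² + |f/r|²) ∈ [0, ∞]` for a scalar `f` ((1.6)). [cite: LiuXu2023, (1.6)] -/
def eHdotOneAxiSq (f : EuclideanSpace ℝ (Fin 3) → ℝ) : ℝ≥0∞ :=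
  ∫⁻ x, ENNReal.ofReal (hdotOneAxiDensity f x)

/-- `‖W‖²_{Ḣ¹_axi} ∈ [0, ∞]` for a triple of components written as a vector field ((1.6)).
[cite: LiuXu2023, (1.6)] -/
def eHdotOneAxiSqVec (W : EuclideanSpace ℝ (Fin 3) → EuclideanSpace ℝ (Fin 3)) : ℝ≥0∞ :=
  ∫⁻ x, ENNReal.ofReal (hdotOneAxiDensityVec W x)

/-- The densities are nonnegative. [cite: LiuXu2023, (1.6)] -/
theorem hdotOneAxiDensity_nonneg (f : EuclideanSpace ℝ (Fin 3) → ℝ) (x : EuclideanSpace ℝ (Fin 3)) :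
    0 ≤ hdotOneAxiDensity f x := by
  unfold hdotOneAxiDensity; positivity

/-- The vector densities are nonnegative. [cite: LiuXu2023, (1.6)] -/
theorem hdotOneAxiDensityVec_nonneg (W : EuclideanSpace ℝ (Fin 3) → EuclideanSpace ℝ (Fin 3))
    (x : EuclideanSpace ℝ (Fin 3)) : 0 ≤ hdotOneAxiDensityVec W x := by
  unfold hdotOneAxiDensityVec; positivity

/-- **`𝔘₀ = 0` for axisymmetric data** (Rem 1.1 (i): "`u₀` is axisymmetric when `𝔘₀` vanishes" —
here the converse direction, the one used to specialise the theorem: infinitesimal axisymmetry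
`Du(x)[J x] = J (u x)`, tree lemma `IsAxisymmetric.fderiv_rotGen`). [cite: LiuXu2023, Rem 1.1 (i)] -/
theorem angularDerivVec_eq_zero_of_isAxisymmetric
    {u : EuclideanSpace ℝ (Fin 3) → EuclideanSpace ℝ (Fin 3)} (hu : IsAxisymmetric u)
    {x : EuclideanSpace ℝ (Fin 3)} (hd : DifferentiableAt ℝ u x) : angularDerivVec u x = 0 := by
  rw [angularDerivVec, hu.fderiv_rotGen hd, sub_self]

/-- Hence for a differentiable axisymmetric field the angular-derivative field is the zero field.
[cite: LiuXu2023, Rem 1.1 (i)] -/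
theorem angularDerivVec_eq_zero_fun_of_isAxisymmetric
    {u : EuclideanSpace ℝ (Fin 3) → EuclideanSpace ℝ (Fin 3)} (hu : IsAxisymmetric u)
    (hd : Differentiable ℝ u) : angularDerivVec u = 0 := by
  funext x
  exact angularDerivVec_eq_zero_of_isAxisymmetric hu (hd x)

/-- The `Ḣ¹_axi` seminorm of the zero triple vanishes. [cite: LiuXu2023, (1.6)] -/
@[simp] theorem eHdotOneAxiSqVec_zero :
    eHdotOneAxiSqVec (0 : EuclideanSpace ℝ (Fin 3) → EuclideanSpace ℝ (Fin 3)) = 0 := by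
  simp [eHdotOneAxiSqVec, hdotOneAxiDensityVec]

end LiuXu2023

open LiuXu2023

/-! ### The named fact -/

/-- **Liu–Xu 2023, Theorem 1.1 (global strong solutions for almost axisymmetric data).**
"Let `u₀ ∈ H²` with `div u₀ = 0` and `𝔘₀ := (∂_θu^r₀, ∂_θu^θ₀, ∂_θu^z₀) ∈ H¹_axi`.  If there exists
some small positive constant `ε` such that the following two smallness conditions hold:
`‖u^θ₀‖_{L²}‖u^θ₀‖_{Ḣ¹_axi} exp(C‖u₀‖⁶_{L²}‖u₀‖²_{Ḣ²}) < ε` (1.7),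
`‖𝔘₀‖_{L²}‖𝔘₀‖_{Ḣ¹_axi} exp(exp(C‖u₀‖⁶_{L²}‖u₀‖²_{Ḣ²})) < ε` (1.8), then (1.1) [has a] unique
global strong solution `u` in `C(ℝ₊;H¹) ∩ L²(ℝ₊;Ḣ¹∩Ḣ²)`" (`ν = 1`, `C` universal).  Rendered
(module docstring): there are universal `ε, C > 0` such that every classical solution of the
unforced system with `ν = 1` on `ℝ³ × [0, T)`, Leray–Hopf on `[0, T)`, whose rapidly decaying datum
`u₀ = u 0` has `Δu₀ ∈ L²`, `u^θ₀ = swirlVelocity u₀` of finite `Ḣ¹_axi` seminorm,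
`𝔘₀ = angularDerivVec u₀ ∈ L² ∩ Ḣ¹_axi`, and satisfies (1.7)–(1.8) with these `ε, C`
(`‖u₀‖_{Ḣ²} := ‖Δu₀‖_{L²}`), extends past `T`.  Statement only; users take
`(h : LiuXu2023_almostAxisymmetric_global)`.
[cite: LiuXu2023, Thm 1.1 (arXiv:2305.01046 pp. 3–4, (1.6)–(1.8)); Notations p. 5 (C universal)] -/
def LiuXu2023_almostAxisymmetric_global : Prop :=
  ∃ ε C : ℝ, 0 < ε ∧ 0 < C ∧
    ∀ (T : ℝ), 0 < T →
    ∀ (u : ℝ → EuclideanSpace ℝ (Fin 3) → EuclideanSpace ℝ (Fin 3))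
      (p : ℝ → EuclideanSpace ℝ (Fin 3) → ℝ),
      IsClassicalNSSolutionOn (Ico 0 T) 1 0 u p → IsLerayHopfOn T 1 0 (u 0) u →
      HasRapidSpatialDecay (u 0) →
      -- `u₀ ∈ H²` (with `u₀ ∈ L²` from the Leray–Hopf class): `Δu₀ ∈ L²`
      eLpNorm (Δ (u 0)) 2 volume < ∞ →
      -- `u^θ₀ ∈ Ḣ¹_axi`, `𝔘₀ ∈ H¹_axi = L² ∩ Ḣ¹_axi`
      eHdotOneAxiSq (swirlVelocity (u 0)) < ∞ →
      eLpNorm (angularDerivVec (u 0)) 2 volume < ∞ →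
      eHdotOneAxiSqVec (angularDerivVec (u 0)) < ∞ →
      -- (1.7)
      (eLpNorm (swirlVelocity (u 0)) 2 volume).toReal *
          Real.sqrt (eHdotOneAxiSq (swirlVelocity (u 0))).toReal *
          Real.exp (C * (eLpNorm (u 0) 2 volume).toReal ^ 6 *
            (eLpNorm (Δ (u 0)) 2 volume).toReal ^ 2) < ε →
      -- (1.8)
      (eLpNorm (angularDerivVec (u 0)) 2 volume).toReal *
          Real.sqrt (eHdotOneAxiSqVec (angularDerivVec (u 0))).toReal *
          Real.exp (Real.exp (C * (eLpNorm (u 0) 2 volume).toReal ^ 6 *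
            (eLpNorm (Δ (u 0)) 2 volume).toReal ^ 2)) < ε →
      HasSmoothExtensionPast 1 0 u T

/-! ### API -/

namespace LiuXu2023_almostAxisymmetric_global

/-- **The axisymmetric small-swirl case** (Rem 1.1 (i): for axisymmetric data `𝔘₀ = 0`, so (1.8)
holds trivially and only the swirl condition (1.7) remains — the shape of the classical
"small `u^θ₀`" results quoted on p. 3): under the fact, a classical Leray–Hopf solution with
`ν = 1` from a rapidly decaying AXISYMMETRIC datum with `Δu₀ ∈ L²`, `u^θ₀ ∈ Ḣ¹_axi` and
`‖u^θ₀‖_{L²}‖u^θ₀‖_{Ḣ¹_axi} exp(C‖u₀‖⁶_{L²}‖Δu₀‖²_{L²}) < ε` extends past `T`.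
[cite: LiuXu2023, Thm 1.1 with Rem 1.1 (i)] -/
theorem axisymmetric_smallSwirl (h : LiuXu2023_almostAxisymmetric_global) :
    ∃ ε C : ℝ, 0 < ε ∧ 0 < C ∧
      ∀ (T : ℝ), 0 < T →
      ∀ (u : ℝ → EuclideanSpace ℝ (Fin 3) → EuclideanSpace ℝ (Fin 3))
        (p : ℝ → EuclideanSpace ℝ (Fin 3) → ℝ),
        IsClassicalNSSolutionOn (Ico 0 T) 1 0 u p → IsLerayHopfOn T 1 0 (u 0) u →
        HasRapidSpatialDecay (u 0) → IsAxisymmetric (u 0) →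
        eLpNorm (Δ (u 0)) 2 volume < ∞ →
        eHdotOneAxiSq (swirlVelocity (u 0)) < ∞ →
        (eLpNorm (swirlVelocity (u 0)) 2 volume).toReal *
            Real.sqrt (eHdotOneAxiSq (swirlVelocity (u 0))).toReal *
            Real.exp (C * (eLpNorm (u 0) 2 volume).toReal ^ 6 *
              (eLpNorm (Δ (u 0)) 2 volume).toReal ^ 2) < ε →
        HasSmoothExtensionPast 1 0 u T := by
  obtain ⟨ε, C, hε, hC, hmain⟩ := h
  refine ⟨ε, C, hε, hC, fun T hT u p hcl hLH hdec hax hH2 hsw h17 => ?_⟩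
  have hd : Differentiable ℝ (u 0) :=
    (hcl.contDiff_velocity (left_mem_Ico.mpr hT)).differentiable (by simp)
  have hU : angularDerivVec (u 0) = 0 := angularDerivVec_eq_zero_fun_of_isAxisymmetric hax hd
  refine hmain T hT u p hcl hLH hdec hH2 hsw ?_ ?_ h17 ?_
  · rw [hU]; simp
  · rw [hU]; simp
  · rw [hU]; simpa using hε

end LiuXu2023_almostAxisymmetric_global

end Literature.Analysis.FluidPDE

end
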